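import Summits.ValiantsHypothesis.ValiantsHypothesis.Theorems.SymmetroidPencilBasics

/-!
# `MatrixDescartes` census — DOOR A at `(3,4)`: THE CONFLUENT NINE, part 1 (kernel) — the confluent Vandermonde kernel of a
# fewnomial with a maximal-order root, and the `(3,3)` identity-bottom pencil as an explicit ten-term fewnomial (ALL supports)

HONEST FRAMING.  Object-search cell `pub-symmetroid`, door-A seat `val-sym-door-p3` (g25); helper file beside the OPEN typed
statement `DoorA34 = PosRootLawAt 3 4 18` (route item `Theses.LacunarySymmetroid.DoorA34`, stmt-ValiantsHypothesis-19980),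
asserted nowhere here.  The cell's one mechanism of record with ceiling `19` at `(3,4)` is the flag ladder over a `(3,3)` SOURCE
row `S₀ + X^{d₁}S₁ + X^{d₂}S₂` with nine positive det-roots and a DEFINITE bottom letter, all of PSD type (Claim L); located
capacity `7`, located law «capacity = maximal realisable contact order + 1» (DOOR-A34-ENG2G3 §3: exact contact-order table,
kernel instance `NoNinefold.not_ninefold_root` on ONE support).  This part supplies the all-supports algebra of the maximal
contact order; part 2 (`…CensusDoorA34ConfluentNine`) draws the chamber law.

* §1 CONFLUENCE (general fewnomials `∑_{i∈s} cᵢ X^{nᵢ}` over `ℝ`): the Euler operator `θ = X·d/dX` lowers the order of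
  vanishing at `1` by one (`dvd_X_mul_derivative`, `dvd_iterate_theta`) and acts diagonally on monomials (`iterate_theta_sum`),
  so `(X − 1)^N ∣ ∑ cᵢ X^{nᵢ}` kills the power moments `∑ cᵢ nᵢ^m`, `m < N` (`moment_eq_zero`), hence `∑ cᵢ g(nᵢ) = 0` for every
  polynomial `g` of degree `< N` (`sum_mul_eval_eq_zero`), hence — testing with `g = ∏_{l ≠ i₀,i}(X − n_l)` when `#s ≤ N + 1` — the
  TWO-POINT RELATION `c_{i₀}·∏_{l≠i₀,i}(n_{i₀} − n_l) + c_i·∏_{l≠i₀,i}(n_i − n_l) = 0` (`two_point_relation`, bookkeeping form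
  `two_point_relation'`): with distinct exponents every coefficient is the explicit multiple `−∏(n_{i₀} − n_l)/∏(n_i − n_l)` of
  `c_{i₀}` — the kernel of the confluent Vandermonde system is the line through `(1/∏_{l≠i}(nᵢ − n_l))ᵢ`.
* §2 the census pencil `det(1 + X^{d₁}S₁ + X^{d₂}S₂)` (ANY real `3 × 3` letters, ANY `d₁, d₂`) IS the ten-term fewnomial
  `∑_{j+k≤3} m_{jk} X^{jd₁+kd₂}` with the mixed invariants `1, tr S₁, tr S₂, e₂S₁, e₂(S₁,S₂), e₂S₂, det S₁, tr(adj S₁·S₂),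
  tr(adj S₂·S₁), det S₂` as coefficients (`det_one_add_add_fin_three` at real points + `Polynomial.funext`:
  `det_pencil_eq_sum_ten`), in the `Fin 10`-indexed form the §1 lemmas consume.

Nothing here bounds `ζ_sym(3,3)` or `ζ_sym(3,4)`; `DoorA34`, Claim L and `MatrixDescartes` (stmt-ValiantsHypothesis-18050) stay
OPEN; registers unchanged; nothing on `VP ≠ VNP`.
[folklore] Euler operator / divided differences (confluent Vandermonde), Leibniz expansion of a `3 × 3` determinant;
certificates by `ring` / `simp`.
-/

-- `Summit.ValiantsHypothesis.ValiantsHypothesis.…` repeats a component by the D-0017 layout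
-- (single-conjunct summit), which the `dupNamespace` linter flags; the name is mandated.
set_option linter.dupNamespace false

namespace Summit.ValiantsHypothesis.ValiantsHypothesis.Theorems.LacunarySymmetroidMatrixDescartes.Census.ConfluentNine

open Polynomial Finset
open scoped BigOperators

/-! ## 1. Confluence: the Euler operator `θ = X·d/dX` and the moments of a fewnomial with a high-order root at `1` -/

/-- One application of `θ = X · d/dX` lowers the order of vanishing at `1` by at most one. [folklore] -/
theorem dvd_X_mul_derivative {p : ℝ[X]} {k : ℕ} (h : (X - C 1) ^ (k + 1) ∣ p) :
    (X - C 1) ^ k ∣ X * derivative p := by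
  obtain ⟨q, rfl⟩ := h
  rw [derivative_mul, derivative_pow, derivative_sub, derivative_X, derivative_C, sub_zero, mul_one,
    Nat.add_sub_cancel]
  exact Dvd.dvd.mul_left
    (dvd_add (Dvd.dvd.mul_right (dvd_mul_left _ _) _) (Dvd.dvd.mul_right (pow_dvd_pow _ (Nat.le_succ k)) _)) _

/-- Iterating `θ` `m` times costs `m` orders of vanishing at `1`. [folklore] -/
theorem dvd_iterate_theta {p : ℝ[X]} {k m : ℕ} (h : (X - C 1) ^ (k + m) ∣ p) :
    (X - C 1) ^ k ∣ (fun q : ℝ[X] => X * derivative q)^[m] p := by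
  induction m generalizing k with
  | zero => simpa using h
  | succ m ih =>
    rw [Function.iterate_succ_apply']
    exact dvd_X_mul_derivative (ih (by rw [show k + 1 + m = k + (m + 1) by omega]; exact h))

/-- `θ` acts diagonally on monomials: `θ^m (∑ cᵢ X^{nᵢ}) = ∑ cᵢ nᵢ^m X^{nᵢ}`. [folklore] -/
theorem iterate_theta_sum {ι : Type*} (s : Finset ι) (c : ι → ℝ) (n : ι → ℕ) (m : ℕ) :
    (fun q : ℝ[X] => X * derivative q)^[m] (∑ i ∈ s, C (c i) * X ^ n i)
      = ∑ i ∈ s, C (c i * (n i : ℝ) ^ m) * X ^ n i := by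
  induction m with
  | zero => simp
  | succ m ih =>
    rw [Function.iterate_succ_apply', ih, derivative_sum, Finset.mul_sum]
    refine Finset.sum_congr rfl fun i _ => ?_
    rw [derivative_C_mul_X_pow]
    rcases Nat.eq_zero_or_pos (n i) with h0 | hpos
    · simp [h0]
    · obtain ⟨k, hk⟩ := Nat.exists_eq_succ_of_ne_zero hpos.ne'
      rw [hk, Nat.succ_sub_one, pow_succ, pow_succ (X : ℝ[X]) k]
      simp only [Nat.cast_succ, map_mul, map_add, map_one, map_natCast, map_pow]
      ring

/-- **Moments vanish.**  If `(X − 1)^N` divides the fewnomial `∑ cᵢ X^{nᵢ}`, then its power moments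
`∑ cᵢ nᵢ^m` vanish for every `m < N`. [folklore] -/
theorem moment_eq_zero {ι : Type*} (s : Finset ι) (c : ι → ℝ) (n : ι → ℕ) {N : ℕ}
    (h : (X - C 1) ^ N ∣ ∑ i ∈ s, C (c i) * X ^ n i) {m : ℕ} (hm : m < N) :
    ∑ i ∈ s, c i * (n i : ℝ) ^ m = 0 := by
  obtain ⟨k, hk⟩ := Nat.exists_eq_add_of_lt hm
  have h' : (X - C 1) ^ ((k + 1) + m) ∣ ∑ i ∈ s, C (c i) * X ^ n i := by
    rw [show (k + 1) + m = N by omega]; exact h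
  have h1 := dvd_iterate_theta h'
  rw [iterate_theta_sum, pow_succ] at h1
  have h2 : (X - C (1 : ℝ)) ∣ ∑ i ∈ s, C (c i * (n i : ℝ) ^ m) * X ^ n i := (dvd_mul_left _ _).trans h1
  rw [dvd_iff_isRoot, IsRoot, eval_finsetSum] at h2
  simpa using h2

/-- Consequently `∑ cᵢ g(nᵢ) = 0` for every polynomial `g` of degree `< N`. [folklore] -/
theorem sum_mul_eval_eq_zero {ι : Type*} (s : Finset ι) (c : ι → ℝ) (n : ι → ℕ) {N : ℕ}
    (h : (X - C 1) ^ N ∣ ∑ i ∈ s, C (c i) * X ^ n i) (g : ℝ[X]) (hg : g.natDegree < N) :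
    ∑ i ∈ s, c i * g.eval (n i : ℝ) = 0 := by
  simp_rw [eval_eq_sum_range' hg, Finset.mul_sum]
  rw [Finset.sum_comm]
  refine Finset.sum_eq_zero fun m hm => ?_
  have hmN : m < N := Finset.mem_range.mp hm
  calc ∑ i ∈ s, c i * (g.coeff m * (n i : ℝ) ^ m) = g.coeff m * ∑ i ∈ s, c i * (n i : ℝ) ^ m := by
        rw [Finset.mul_sum]; exact Finset.sum_congr rfl fun i _ => by ring
    _ = 0 := by rw [moment_eq_zero s c n h hmN, mul_zero]

/-- **Two-point confluence relation.**  If `(X − 1)^N ∣ ∑_{i ∈ s} cᵢ X^{nᵢ}` with `#s ≤ N + 1`, then for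
any two indices `i₀ ≠ i` of `s` the coefficients satisfy
`c_{i₀} · ∏_{l ≠ i₀, i} (n_{i₀} − n_l) + c_i · ∏_{l ≠ i₀, i} (n_i − n_l) = 0`
(test polynomial `∏_{l ≠ i₀, i} (X − n_l)` of degree `#s − 2 < N`): with distinct exponents every coefficient is
the explicit multiple `−∏(n_{i₀} − n_l)/∏(n_i − n_l)` of `c_{i₀}` — the confluent Vandermonde kernel. [folklore] -/
theorem two_point_relation {ι : Type*} [DecidableEq ι] (s : Finset ι) (c : ι → ℝ) (n : ι → ℕ) {N : ℕ}
    (h : (X - C 1) ^ N ∣ ∑ i ∈ s, C (c i) * X ^ n i) (hcard : s.card ≤ N + 1)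
    {i₀ i : ι} (hi₀ : i₀ ∈ s) (hi : i ∈ s) (hne : i ≠ i₀) :
    c i₀ * ∏ l ∈ (s.erase i₀).erase i, ((n i₀ : ℝ) - n l)
      + c i * ∏ l ∈ (s.erase i₀).erase i, ((n i : ℝ) - n l) = 0 := by
  set g : ℝ[X] := ∏ l ∈ (s.erase i₀).erase i, (X - C (n l : ℝ)) with hg
  have hi' : i ∈ s.erase i₀ := Finset.mem_erase.mpr ⟨hne, hi⟩
  have hcard2 : ((s.erase i₀).erase i).card + 2 = s.card := by
    rw [Finset.card_erase_of_mem hi', Finset.card_erase_of_mem hi₀]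
    have : 2 ≤ s.card := by
      calc 2 = ({i₀, i} : Finset ι).card := by rw [Finset.card_pair hne.symm]
        _ ≤ s.card := Finset.card_le_card (by
            intro x hx
            rcases Finset.mem_insert.mp hx with rfl | hx
            · exact hi₀
            · rw [Finset.mem_singleton] at hx; rw [hx]; exact hi)
    omega
  have hdeg : g.natDegree < N := by
    calc g.natDegree ≤ ∑ l ∈ (s.erase i₀).erase i, (X - C (n l : ℝ)).natDegree := natDegree_prod_le _ _
      _ ≤ ∑ l ∈ (s.erase i₀).erase i, 1 :=
          Finset.sum_le_sum (f := fun l => (X - C (n l : ℝ)).natDegree) (g := fun _ => 1)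
            fun l _ => natDegree_X_sub_C_le (n l : ℝ)
      _ = ((s.erase i₀).erase i).card := by simp
      _ < N := by omega
  have hsum := sum_mul_eval_eq_zero s c n h g hdeg
  have hvan : ∀ l ∈ (s.erase i₀).erase i, c l * g.eval (n l : ℝ) = 0 := by
    intro l hl
    rw [hg, eval_prod]
    rw [Finset.prod_eq_zero hl (by simp), mul_zero]
  rw [← Finset.add_sum_erase _ _ hi₀, ← Finset.add_sum_erase _ _ hi', Finset.sum_eq_zero hvan, add_zero] at hsum
  have e1 : g.eval (n i₀ : ℝ) = ∏ l ∈ (s.erase i₀).erase i, ((n i₀ : ℝ) - n l) := by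
    rw [hg, eval_prod]; simp
  have e2 : g.eval (n i : ℝ) = ∏ l ∈ (s.erase i₀).erase i, ((n i : ℝ) - n l) := by
    rw [hg, eval_prod]; simp
  rw [e1, e2] at hsum
  exact hsum


/-- Product over a doubly-erased finset as a product with two unit factors (bookkeeping form of
`two_point_relation` that evaluates by `simp` on explicit index types). [folklore] -/
theorem prod_erase_erase_eq {ι : Type*} [DecidableEq ι] (s : Finset ι) (f : ι → ℝ) {i₀ i : ι}
    (hi : i ∈ s) (hne : i ≠ i₀) :
    ∏ l ∈ (s.erase i₀).erase i, f l = ∏ l ∈ s, (if l = i₀ ∨ l = i then 1 else f l) := by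
  have hi' : i ∈ s.erase i₀ := Finset.mem_erase.mpr ⟨hne, hi⟩
  rw [← Finset.prod_erase (s := s) (f := fun l => if l = i₀ ∨ l = i then (1 : ℝ) else f l) (a := i₀) (by simp),
    ← Finset.prod_erase (s := s.erase i₀) (f := fun l => if l = i₀ ∨ l = i then (1 : ℝ) else f l) (a := i) (by simp)]
  refine Finset.prod_congr rfl fun l hl => ?_
  have h1 : l ≠ i := (Finset.mem_erase.mp hl).1
  have h2 : l ≠ i₀ := (Finset.mem_erase.mp (Finset.mem_erase.mp hl).2).1
  simp [h1, h2]

/-- `two_point_relation` in bookkeeping form. [folklore] -/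
theorem two_point_relation' {ι : Type*} [DecidableEq ι] (s : Finset ι) (c : ι → ℝ) (n : ι → ℕ) {N : ℕ}
    (h : (X - C 1) ^ N ∣ ∑ i ∈ s, C (c i) * X ^ n i) (hcard : s.card ≤ N + 1)
    {i₀ i : ι} (hi₀ : i₀ ∈ s) (hi : i ∈ s) (hne : i ≠ i₀) :
    c i₀ * ∏ l ∈ s, (if l = i₀ ∨ l = i then 1 else ((n i₀ : ℝ) - n l))
      + c i * ∏ l ∈ s, (if l = i₀ ∨ l = i then 1 else ((n i : ℝ) - n l)) = 0 := by
  rw [← prod_erase_erase_eq s _ hi hne, ← prod_erase_erase_eq s _ hi hne]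
  exact two_point_relation s c n h hcard hi₀ hi hne

/-! ## 2. The `(3,3)` pencil with identity bottom letter as a ten-term fewnomial -/

/-- `det(1 + s·A + t·B)` for `3 × 3` matrices as a cubic in `(s,t)` with the ten mixed invariants
`1, tr A, tr B, e₂ A, e₂(A,B), e₂ B, det A, tr(adj A·B), tr(adj B·A), det B` as coefficients. [folklore] -/
theorem det_one_add_add_fin_three (A B : Matrix (Fin 3) (Fin 3) ℝ) (s t : ℝ) :
    (1 + s • A + t • B).det
      = 1 + A.trace * s + B.trace * t
        + (A 0 0 * A 1 1 - A 0 1 * A 1 0 + (A 0 0 * A 2 2 - A 0 2 * A 2 0) + (A 1 1 * A 2 2 - A 1 2 * A 2 1)) * s ^ 2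
        + (A 0 0 * B 1 1 + B 0 0 * A 1 1 - A 0 1 * B 1 0 - B 0 1 * A 1 0
            + (A 0 0 * B 2 2 + B 0 0 * A 2 2 - A 0 2 * B 2 0 - B 0 2 * A 2 0)
            + (A 1 1 * B 2 2 + B 1 1 * A 2 2 - A 1 2 * B 2 1 - B 1 2 * A 2 1)) * (s * t)
        + (B 0 0 * B 1 1 - B 0 1 * B 1 0 + (B 0 0 * B 2 2 - B 0 2 * B 2 0) + (B 1 1 * B 2 2 - B 1 2 * B 2 1)) * t ^ 2
        + A.det * s ^ 3 + (A.adjugate * B).trace * (s ^ 2 * t) + (B.adjugate * A).trace * (s * t ^ 2)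
        + B.det * t ^ 3 := by
  simp only [Matrix.det_fin_three, Matrix.adjugate_fin_three, Matrix.trace_fin_three, Matrix.mul_apply,
    Fin.sum_univ_three, Matrix.add_apply, Matrix.smul_apply, Matrix.one_apply, smul_eq_mul]
  simp
  ring

/-- **The ten-term fewnomial.**  For every support `(0, d₁, d₂)` and all real `3 × 3` letters `S₁, S₂`, the census
pencil determinant `det(1 + X^{d₁}S₁ + X^{d₂}S₂)` is the explicit fewnomial `∑_{j+k ≤ 3} m_{jk}(S₁,S₂)·X^{j d₁ + k d₂}`
(mixed invariants as in `det_one_add_add_fin_three`). [folklore] -/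
theorem det_pencil_eq_sum_ten (d₁ d₂ : ℕ) (S₁ S₂ : Matrix (Fin 3) (Fin 3) ℝ) :
    (∑ l, (X : ℝ[X]) ^ (![0, d₁, d₂] : Fin 3 → ℕ) l • ((![1, S₁, S₂] : Fin 3 → Matrix (Fin 3) (Fin 3) ℝ) l).map C).det
      = ∑ i : Fin 10, C ((![1, S₁.trace, S₂.trace,
            S₁ 0 0 * S₁ 1 1 - S₁ 0 1 * S₁ 1 0 + (S₁ 0 0 * S₁ 2 2 - S₁ 0 2 * S₁ 2 0) + (S₁ 1 1 * S₁ 2 2 - S₁ 1 2 * S₁ 2 1),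
            S₁ 0 0 * S₂ 1 1 + S₂ 0 0 * S₁ 1 1 - S₁ 0 1 * S₂ 1 0 - S₂ 0 1 * S₁ 1 0
              + (S₁ 0 0 * S₂ 2 2 + S₂ 0 0 * S₁ 2 2 - S₁ 0 2 * S₂ 2 0 - S₂ 0 2 * S₁ 2 0)
              + (S₁ 1 1 * S₂ 2 2 + S₂ 1 1 * S₁ 2 2 - S₁ 1 2 * S₂ 2 1 - S₂ 1 2 * S₁ 2 1),
            S₂ 0 0 * S₂ 1 1 - S₂ 0 1 * S₂ 1 0 + (S₂ 0 0 * S₂ 2 2 - S₂ 0 2 * S₂ 2 0) + (S₂ 1 1 * S₂ 2 2 - S₂ 1 2 * S₂ 2 1),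
            S₁.det, (S₁.adjugate * S₂).trace, (S₂.adjugate * S₁).trace, S₂.det] : Fin 10 → ℝ) i)
          * X ^ ((![0, d₁, d₂, 2 * d₁, d₁ + d₂, 2 * d₂, 3 * d₁, 2 * d₁ + d₂, d₁ + 2 * d₂, 3 * d₂] : Fin 10 → ℕ) i) := by
  apply Polynomial.funext
  intro x
  rw [SymmetroidDescartes.eval_det_pencil]
  have hL : (∑ l, x ^ (![0, d₁, d₂] : Fin 3 → ℕ) l • (![1, S₁, S₂] : Fin 3 → Matrix (Fin 3) (Fin 3) ℝ) l)
      = 1 + x ^ d₁ • S₁ + x ^ d₂ • S₂ := by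
    simp [Fin.sum_univ_three]
  rw [hL, det_one_add_add_fin_three, eval_finsetSum]
  simp only [Fin.sum_univ_succ, Fin.sum_univ_zero, eval_mul, eval_C, eval_pow, eval_X]
  simp
  ring

end Summit.ValiantsHypothesis.ValiantsHypothesis.Theorems.LacunarySymmetroidMatrixDescartes.Census.ConfluentNine
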